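import Summits.CriticalPhenomena.PercolationContinuityZ3.Theorems.Transplant.KNCells2Exit
import Summits.CriticalPhenomena.PercolationContinuityZ3.Theorems.Transplant.SamePThetaPosOfLawful
import HarnessLib

/-!
# F8 (generic, lag-1 anchors) under design (D) CONCENTRIC: the node theorem WITHOUT the envelope bound — a valid anchored cells scheme at `p`
# gives `θ_{root}(p) > 0` directly (Peierls half), so no uniform `hB`/`N` is needed (HOME/ENTRY-SEED-STAR.md §10, lead V56 order G2/G3)

builds on p205010 (kernel theorem, internal audit signed; external expert review pending) — nothing in this file uses p205010.
Lane `prim-bschramm`, lead seat (gen 2) for p2-g2's generic layer; helper file (`--supports stmt-CriticalPhenomena-4575`).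

* **`theta_pos_of_cells₂`** — `RunGeom`, `AnchGeom`, `SepGeom₂`, `ExitGeom`, `δc ≤ 1`, `ε ≤ 2⁻³²`, `0 < p`, (32) at the root (`hQ0`) and the
  failure bound after valid histories (`hfail`) ⟹ `0 < θ_{root}(p)`.  Compared with `samePWitnessAt_of_cells₂` (p215537) the degree bound `hΔ`
  and the envelope bound `hB` are GONE: they served only Theorem A's perturbation step, which design (D) replaces by re-running the
  construction at a smaller density (`SameP.theta_pos_of_lawful`, p218990).  With growing fibre radii (anchor type `A := ℕ`-stage counter)
  the envelopes are finite per probe but not uniformly bounded — exactly what this form allows.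
[cite: KozmaNitzan2024, §4 Theorem 6 (pp. 25–31), §1 p. 2 (approach 1)]
-/

noncomputable section

open MeasureTheory ProbabilityTheory
open scoped ENNReal Classical

namespace Summit.CriticalPhenomena.PercolationContinuityZ3.Theorems

namespace Transplant

namespace KNCells

open Literature.Probability.Percolation Literature.Probability.LatticeModels SimpleGraph GadgetSystem ProbeHistory HSiteScheme Contour

variable {V : Type} [DecidableEq V] [Countable V]

namespace KSchA

variable {A : Type*} {G : SimpleGraph V} [G.LocallyFinite] {S : KSchA V A}

/-- **The anchored cells scheme forces `θ_{root}(p) > 0` — no envelope bound.** [cite: KozmaNitzan2024, §4 Theorem 6 (pp. 25–31)] -/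
theorem theta_pos_of_cells₂ (hΓ : RunGeom G S.Γ) (hA : AnchGeom S.Γ) (hsep : SepGeom₂ G S.Γ) (hX : ExitGeom G S.Γ)
    (hδc : S.δc ≤ 1) {ε : ℝ} (hε : ε ≤ (1 / 2) ^ 32) (hp : 0 < (S.p : ℝ))
    (hQ0 : ∀ du : MDir, 1 - S.δc < (prodBernoulli (pinW (KNLevels.lattW G S.p) ↑(S.U₀ G) ↑(S.U₀ G))).real
      (⋃ t ∈ (↑(S.Γ.M S.Γ.a₀ ((0 : Site 2) + stepVec du)) : Set V),
        openConnIn (↑(S.Γ.Q S.Γ.a₀ 0 ∪ S.Γ.Ewv S.Γ.a₀ 0 du) : Set V) S.Γ.root t))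
    (hfail : ∀ h e, S.Valid₂ G h e →
      (bondPercolation G S.p).real
        {ω | ¬S.succ₂ G h e (S.aOf₁ G h e) (S.aOf₂ G h e) ((S.probe₂ G h e (S.aOf₁ G h e) (S.aOf₂ G h e)).read ω)} ≤ ε) :
    0 < theta G S.Γ.root S.p :=
  SameP.theta_pos_of_lawful (lawful₂ hΓ hA hsep hQ0 hfail) hε
    (fun x hx => (mem_edgesIn_iff.1 (Finset.mem_coe.1 hx)).1) hp
    (by
      rintro ω' ⟨hA', hinf⟩
      exact Or.inl (mem_percolatesAt_of_infinite₂ hΓ hA hX (ω := ω') hδc hA' hinf))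

/-- Hence `p_c(G, root) ≤ p` for such a scheme at `p`. [cite: KozmaNitzan2024, §1 p. 2 (approach 1)] -/
theorem criticalProb_le_of_cells₂ (hΓ : RunGeom G S.Γ) (hA : AnchGeom S.Γ) (hsep : SepGeom₂ G S.Γ) (hX : ExitGeom G S.Γ)
    (hδc : S.δc ≤ 1) {ε : ℝ} (hε : ε ≤ (1 / 2) ^ 32) (hp : 0 < (S.p : ℝ))
    (hQ0 : ∀ du : MDir, 1 - S.δc < (prodBernoulli (pinW (KNLevels.lattW G S.p) ↑(S.U₀ G) ↑(S.U₀ G))).real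
      (⋃ t ∈ (↑(S.Γ.M S.Γ.a₀ ((0 : Site 2) + stepVec du)) : Set V),
        openConnIn (↑(S.Γ.Q S.Γ.a₀ 0 ∪ S.Γ.Ewv S.Γ.a₀ 0 du) : Set V) S.Γ.root t))
    (hfail : ∀ h e, S.Valid₂ G h e →
      (bondPercolation G S.p).real
        {ω | ¬S.succ₂ G h e (S.aOf₁ G h e) (S.aOf₂ G h e) ((S.probe₂ G h e (S.aOf₁ G h e) (S.aOf₂ G h e)).read ω)} ≤ ε) :
    criticalProb G S.Γ.root ≤ S.p :=
  OrbitQuotient.criticalProb_le_of_theta_pos G S.Γ.root S.p (theta_pos_of_cells₂ hΓ hA hsep hX hδc hε hp hQ0 hfail)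

end KSchA

end KNCells

end Transplant

end Summit.CriticalPhenomena.PercolationContinuityZ3.Theorems

end
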